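import Summits.NavierStokesRegularity.OSWSelfSimilar.SheetREnergyClass
import Summits.NavierStokesRegularity.OSWSelfSimilar.SheetRVelocityWirtinger
import Literature.Analysis.Fourier.HilbertTransformLineSkewAdjoint
import Literature.Analysis.Fourier.HilbertTransformLineSplit
import HarnessLib

/-!
# SHEET-ℝ frame, the π-endpoint sentence «H∞»: `𝒰δ(ξ) → 0` as `ξ → ±∞` on the WHOLE odd energy class, and the
# unconditional sharp `𝒰`-term inequality of (E5)

HONEST FRAMING (cell ns-blowup GROUP B / zone Z3, case Z3-SR-CERT; 1-D MODEL certificate frame (viscous gCLM/OSW on the line); not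
Euler/NS; «violates: none — MODEL»). Nothing here asserts that a profile exists.

The (E5) `𝒰`-term step of the certificate chain uses `‖𝒰δ‖_{L²(dθ)} ≤ (2L)^{-1/2}‖δ‖_w` (PRICE-impl1 §1; `w = L² + ξ²`,
`𝒰δ(ξ) = ∫₀^ξ Hδ`); `SheetRVelocityWirtinger.integral_velocity_sq_le_of_weightedSq_eq` proves it from the Dirichlet–Wirtinger
inequality PROVIDED `𝒰δ(ξ) → 0` as `ξ → ±∞` («H∞»; with only `𝒰δ(0) = 0` the constant is `2(2L)^{-1/2}`).  This file proves H∞ on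
the whole odd energy class in the primitive form of record (`Ω = Ω(0) + ∫₀Ω₁`, `Ω` odd, `Ω₁` a.e.-strongly measurable, `∫wΩ² < ∞`,
`∫wΩ₁² < ∞` — literally the hypotheses of `SheetREnergyClass.weightedSq_hilbertTransform_of_primitive`; no decay, smoothness or
support hypothesis added; companion of cert-5's dense-class file `SheetRVelocityEndpoint` for odd `C¹_c`, here WITHOUT the closure
passage) and composes:
* §1 `integral_hilbertTransform_eq_zero` — for ANY real `f ∈ L¹ ∩ L²` with symmetric p.v. integrand integrable a.e. and `Hf ∈ L¹`:
  **`∫_ℝ Hf = 0`**, by the tree's skew-adjointness `integral_hilbertTransform_mul_eq_neg` against the Poisson cutoff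
  `g_R = R²/(R² + x²)` (`H g_R = R·x/(R² + x²)`, `hilbertTransform_poissonKernel`): `∫ Hf·g_R = −∫ f·Rx/(R² + x²)`, and `R → ∞` by
  dominated convergence on both sides (`|g_R| ≤ 1`, `g_R → 1`; `|Rx/(R² + x²)| ≤ 1`, `→ 0`).  No Fourier transform, no density step.
* §2 on the class: `HΩ ∈ L¹`, `∫_ℝ HΩ = 0`, `∫_{(0,∞)} HΩ = 0` (`HΩ` even), hence **`Tendsto (fun ξ => ∫ s in (0:ℝ)..ξ, hilbertTransform Ω s)
  atTop (𝓝 0)`** and the same `atBot` (the T2 form of profile-refuter g4, STATUS 2026-08-27 01:00Z).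
* §3 `continuous_hilbertTransform_of_primitive` (`(𝒰Ω)′ = HΩ` everywhere); §4 the T3 composition, every hypothesis of
  `integral_velocity_sq_le_of_weightedSq_eq` discharged: **`∫ (𝒰Ω)²·2L/w ≤ (2L)⁻¹·∫wΩ² ≤ (2/L)·‖Ω‖²_E`**; §5 the `C¹` subclass.
Pure calculus about the tree's operator `hilbertTransform`; no definition, no named fact; MODEL frame bookkeeping only.
WHAT THIS IS NOT: not NS; no number of record is asserted here (the constant switch is the lead's ruling on landing + K-tick).
-/

noncomputable section

namespace Summit.NavierStokesRegularity.OSWSelfSimilar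
namespace SheetRVelocityEndpointClass

open _root_.MeasureTheory _root_.Set _root_.Filter Literature.Analysis.Fourier
  SheetRWeakProfilePV SheetREnergyClass
open scoped Real Topology

/-! ### §1. `∫_ℝ Hf = 0` whenever `Hf ∈ L¹` (`f ∈ L¹ ∩ L²`, genuine principal values a.e.) -/
/-- The Poisson cutoff `g_R(y) = R²·(R² + y²)⁻¹` (`R > 0`) is `C¹`, integrable, in `L²`, with values in `[0, 1]`. [folklore] -/
theorem poissonCutoff_facts {R : ℝ} (hR : 0 < R) :
    ContDiff ℝ 1 (fun y : ℝ => R ^ 2 * (R ^ 2 + y ^ 2)⁻¹) ∧ Integrable (fun y : ℝ => R ^ 2 * (R ^ 2 + y ^ 2)⁻¹) ∧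
      MemLp (fun y : ℝ => R ^ 2 * (R ^ 2 + y ^ 2)⁻¹) 2 ∧
      (∀ y : ℝ, 0 ≤ R ^ 2 * (R ^ 2 + y ^ 2)⁻¹ ∧ R ^ 2 * (R ^ 2 + y ^ 2)⁻¹ ≤ 1) := by
  have hpos : ∀ y : ℝ, 0 < R ^ 2 + y ^ 2 := fun y => by positivity
  have hcd : ContDiff ℝ 1 (fun y : ℝ => R ^ 2 * (R ^ 2 + y ^ 2)⁻¹) :=
    contDiff_const.mul ((contDiff_const.add (contDiff_id.pow 2)).inv fun y => (hpos y).ne')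
  have hint : Integrable (fun y : ℝ => R ^ 2 * (R ^ 2 + y ^ 2)⁻¹) :=
    (SheetRWeightedEmbeddings.integrable_inv_sq_add_sq hR).const_mul (R ^ 2)
  have hval : ∀ y : ℝ, 0 ≤ R ^ 2 * (R ^ 2 + y ^ 2)⁻¹ ∧ R ^ 2 * (R ^ 2 + y ^ 2)⁻¹ ≤ 1 := by
    intro y
    refine ⟨by positivity, ?_⟩
    rw [← div_eq_mul_inv, div_le_one (hpos y)]
    nlinarith [sq_nonneg y]
  have hm : AEStronglyMeasurable (fun y : ℝ => R ^ 2 * (R ^ 2 + y ^ 2)⁻¹) volume := hcd.continuous.aestronglyMeasurable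
  have h2 : MemLp (fun y : ℝ => R ^ 2 * (R ^ 2 + y ^ 2)⁻¹) 2 := by
    rw [memLp_two_iff_integrable_sq hm]
    refine hint.mono' (hm.pow 2) (Eventually.of_forall fun y => ?_)
    obtain ⟨h0, h1⟩ := hval y
    rw [Real.norm_eq_abs, abs_of_nonneg (sq_nonneg _), sq]
    exact mul_le_of_le_one_left h0 h1
  exact ⟨hcd, hint, h2, hval⟩

/-- `H[R²/(R² + y²)](x) = R·x/(R² + x²)` (`R > 0`; the conjugate Poisson kernel, `hilbertTransform_poissonKernel`). [folklore] -/
theorem hilbertTransform_poissonCutoff {R : ℝ} (hR : 0 < R) (x : ℝ) :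
    hilbertTransform (fun y : ℝ => R ^ 2 * (R ^ 2 + y ^ 2)⁻¹) x = R * (x / (R ^ 2 + x ^ 2)) := by
  have e : (fun y : ℝ => R ^ 2 * (R ^ 2 + y ^ 2)⁻¹) = fun y => R * (R / (R ^ 2 + y ^ 2)) := by
    funext y
    rw [div_eq_mul_inv, ← mul_assoc, sq]
  rw [e, hilbertTransform_const_mul, hilbertTransform_poissonKernel hR]

/-- `|R·x/(R² + x²)| ≤ 1`. [folklore] -/
theorem abs_conjPoissonCutoff_le_one {R : ℝ} (hR : 0 < R) (x : ℝ) : |R * (x / (R ^ 2 + x ^ 2))| ≤ 1 := by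
  have hpos : 0 < R ^ 2 + x ^ 2 := by positivity
  rw [← mul_div_assoc, abs_div, abs_of_pos hpos, div_le_one hpos, abs_mul, abs_of_pos hR]
  nlinarith [sq_nonneg (R - |x|), sq_abs x, abs_nonneg x]

/-- The conjugate cutoff is small: `|R·x/(R² + x²)| ≤ |x|/R`. [folklore] -/
theorem abs_conjPoissonCutoff_le {R : ℝ} (hR : 0 < R) (x : ℝ) : |R * (x / (R ^ 2 + x ^ 2))| ≤ |x| / R := by
  have hpos : 0 < R ^ 2 + x ^ 2 := by positivity
  rw [← mul_div_assoc, abs_div, abs_of_pos hpos, abs_mul, abs_of_pos hR, div_le_div_iff₀ hpos hR]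
  nlinarith [sq_nonneg x, abs_nonneg x, mul_nonneg (abs_nonneg x) (sq_nonneg x), sq_nonneg R]

/-- The Poisson cutoff tends to one: `0 ≤ 1 − R²/(R² + x²) ≤ x²/R²`. [folklore] -/
theorem one_sub_poissonCutoff_le {R : ℝ} (hR : 0 < R) (x : ℝ) :
    0 ≤ 1 - R ^ 2 * (R ^ 2 + x ^ 2)⁻¹ ∧ 1 - R ^ 2 * (R ^ 2 + x ^ 2)⁻¹ ≤ x ^ 2 / R ^ 2 := by
  have hpos : 0 < R ^ 2 + x ^ 2 := by positivity
  have hR2 : 0 < R ^ 2 := by positivity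
  have e : 1 - R ^ 2 * (R ^ 2 + x ^ 2)⁻¹ = x ^ 2 / (R ^ 2 + x ^ 2) := by
    field_simp
    ring
  rw [e]
  exact ⟨by positivity, div_le_div_of_nonneg_left (sq_nonneg x) hR2 (by linarith [sq_nonneg x])⟩

/-- **`∫_ℝ Hf = 0` whenever `Hf ∈ L¹`.** For a real `f ∈ L¹ ∩ L²` whose symmetric p.v. integrand is integrable on `(0,∞)` at a.e.
point, if `hilbertTransform f ∈ L¹(ℝ)` then `∫ hilbertTransform f = 0` (skew-adjointness against the Poisson cutoff
`R²/(R² + x²)`, `R → ∞`). [folklore] -/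
theorem integral_hilbertTransform_eq_zero {f : ℝ → ℝ} (hf : Integrable f) (hf2 : MemLp f 2)
    (hint : ∀ᵐ x : ℝ, IntegrableOn (fun t => (f (x - t) - f (x + t)) / t) (Ioi 0))
    (hH : Integrable (hilbertTransform f)) : ∫ x, hilbertTransform f x = 0 := by
  have hRpos : ∀ n : ℕ, (0 : ℝ) < (n : ℝ) + 1 := fun n => by positivity
  set g : ℕ → ℝ → ℝ := fun n y => ((n : ℝ) + 1) ^ 2 * (((n : ℝ) + 1) ^ 2 + y ^ 2)⁻¹ with hg
  set k : ℕ → ℝ → ℝ := fun n x => ((n : ℝ) + 1) * (x / (((n : ℝ) + 1) ^ 2 + x ^ 2)) with hk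
  -- the pairing identity at every level
  have hpair : ∀ n : ℕ, ∫ x, hilbertTransform f x * g n x = -∫ x, f x * k n x := by
    intro n
    obtain ⟨hcd, hgi, hg2, -⟩ := poissonCutoff_facts (hRpos n)
    have h := integral_hilbertTransform_mul_eq_neg hf hf2 hgi hg2 hint
      (ae_of_all _ (integrableOn_symmIntegrand_of_contDiff hcd hgi))
    have e : (fun x => f x * hilbertTransform (g n) x) = fun x => f x * k n x := by
      funext x
      rw [hg, hk]
      simp only
      rw [hilbertTransform_poissonCutoff (hRpos n)]
    rw [h, e]
  -- left side: `∫ Hf·g_n → ∫ Hf`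
  have hL : Tendsto (fun n : ℕ => ∫ x, hilbertTransform f x * g n x) atTop (𝓝 (∫ x, hilbertTransform f x)) := by
    have e : ∫ x, hilbertTransform f x = ∫ x, hilbertTransform f x * 1 := by simp
    rw [e]
    refine tendsto_integral_of_dominated_convergence (fun x => |hilbertTransform f x|) ?_ hH.abs ?_ ?_
    · intro n
      obtain ⟨hcd, -, -, -⟩ := poissonCutoff_facts (hRpos n)
      exact hH.aestronglyMeasurable.mul hcd.continuous.aestronglyMeasurable
    · intro n
      refine Eventually.of_forall fun x => ?_
      obtain ⟨h0, h1⟩ := (poissonCutoff_facts (hRpos n)).2.2.2 x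
      rw [Real.norm_eq_abs, abs_mul, abs_of_nonneg h0]
      exact mul_le_of_le_one_right (abs_nonneg _) h1
    · refine Eventually.of_forall fun x => ?_
      refine Tendsto.const_mul _ ?_
      -- `g_n x → 1`: `0 ≤ 1 − g_n x ≤ x²/(n+1)²`
      have hsmall : Tendsto (fun n : ℕ => x ^ 2 / ((n : ℝ) + 1) ^ 2) atTop (𝓝 0) := by
        have h1 : Tendsto (fun n : ℕ => 1 / ((n : ℝ) + 1)) atTop (𝓝 0) := tendsto_one_div_add_atTop_nhds_zero_nat
        have h2 := (h1.pow 2).const_mul (x ^ 2)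
        simp only [zero_pow two_ne_zero, mul_zero] at h2
        refine h2.congr fun n => ?_
        field_simp
      have hdiff : Tendsto (fun n : ℕ => 1 - g n x) atTop (𝓝 0) :=
        squeeze_zero (fun n => (one_sub_poissonCutoff_le (hRpos n) x).1)
          (fun n => (one_sub_poissonCutoff_le (hRpos n) x).2) hsmall
      have := (tendsto_const_nhds (x := (1 : ℝ))).sub hdiff
      simpa using this
  -- right side: `∫ f·k_n → 0`
  have hR : Tendsto (fun n : ℕ => ∫ x, f x * k n x) atTop (𝓝 0) := by
    have e : (0 : ℝ) = ∫ x : ℝ, f x * 0 := by simp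
    rw [e]
    refine tendsto_integral_of_dominated_convergence (fun x => |f x|) ?_ hf.abs ?_ ?_
    · intro n
      have hc : Continuous (k n) := by
        rw [hk]
        exact continuous_const.mul (continuous_id.div (continuous_const.add (continuous_id.pow 2))
          fun x => (by positivity : (0 : ℝ) < ((n : ℝ) + 1) ^ 2 + x ^ 2).ne')
      exact hf.aestronglyMeasurable.mul hc.aestronglyMeasurable
    · intro n
      refine Eventually.of_forall fun x => ?_
      rw [Real.norm_eq_abs, abs_mul]
      exact mul_le_of_le_one_right (abs_nonneg _) (abs_conjPoissonCutoff_le_one (hRpos n) x)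
    · refine Eventually.of_forall fun x => ?_
      refine Tendsto.const_mul _ ?_
      have hsmall : Tendsto (fun n : ℕ => |x| / ((n : ℝ) + 1)) atTop (𝓝 0) := by
        have h1 : Tendsto (fun n : ℕ => 1 / ((n : ℝ) + 1)) atTop (𝓝 0) := tendsto_one_div_add_atTop_nhds_zero_nat
        have h2 := h1.const_mul |x|
        simp only [mul_zero] at h2
        refine h2.congr fun n => ?_
        field_simp
      exact squeeze_zero_norm (fun n => by rw [Real.norm_eq_abs]; exact abs_conjPoissonCutoff_le (hRpos n) x) hsmall
  -- conclude
  have hL' : Tendsto (fun n : ℕ => ∫ x, hilbertTransform f x * g n x) atTop (𝓝 (-0)) := by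
    simp_rw [hpair]
    exact hR.neg
  rw [neg_zero] at hL'
  exact tendsto_nhds_unique hL hL'

/-! ### §2. H∞ on the whole odd energy class (primitive form of record) -/

/-- On the odd energy class `HΩ ∈ L¹(ℝ)` (weighted isometry `∫w(HΩ)² = ∫wΩ² < ∞` and `L²_w ⊂ L¹`). [folklore] -/
theorem integrable_hilbertTransform_of_primitive {Ω Ω₁ : ℝ → ℝ} {L : ℝ} (hL : 0 < L)
    (hΩ : ∀ x, Ω x = Ω 0 + ∫ s in (0 : ℝ)..x, Ω₁ s) (hodd : ∀ y, Ω (-y) = -Ω y) (hΩ₁m : AEStronglyMeasurable Ω₁ volume)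
    (h0 : Integrable fun y => (L ^ 2 + y ^ 2) * Ω y ^ 2) (h1 : Integrable fun y => (L ^ 2 + y ^ 2) * Ω₁ y ^ 2) :
    Integrable (hilbertTransform Ω) := by
  obtain ⟨hHm, -, hwH, -⟩ := weightedSq_hilbertTransform_of_primitive hL hΩ hodd hΩ₁m h0 h1
  exact SheetRWeightedEmbeddings.integrable_of_weighted_sq hL hHm hwH

/-- **`∫_ℝ HΩ = 0` on the whole odd energy class.** [folklore] -/
theorem integral_hilbertTransform_eq_zero_of_primitive {Ω Ω₁ : ℝ → ℝ} {L : ℝ} (hL : 0 < L)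
    (hΩ : ∀ x, Ω x = Ω 0 + ∫ s in (0 : ℝ)..x, Ω₁ s) (hodd : ∀ y, Ω (-y) = -Ω y) (hΩ₁m : AEStronglyMeasurable Ω₁ volume)
    (h0 : Integrable fun y => (L ^ 2 + y ^ 2) * Ω y ^ 2) (h1 : Integrable fun y => (L ^ 2 + y ^ 2) * Ω₁ y ^ 2) :
    ∫ x, hilbertTransform Ω x = 0 := by
  obtain ⟨-, hΩ₁2, hΩ2, hΩi, -⟩ := basic_of_primitive hL hΩ hΩ₁m h0 h1
  exact integral_hilbertTransform_eq_zero hΩi hΩ2 (ae_of_all _ (integrableOn_symmIntegrand_of_primitive hΩ hΩ₁2 hΩi))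
    (integrable_hilbertTransform_of_primitive hL hΩ hodd hΩ₁m h0 h1)

/-- **`∫_{(0,∞)} HΩ = 0` on the whole odd energy class** (`HΩ` is even, so the half-line mass is half of `∫_ℝ HΩ = 0`). [folklore] -/
theorem setIntegral_Ioi_hilbertTransform_eq_zero_of_primitive {Ω Ω₁ : ℝ → ℝ} {L : ℝ} (hL : 0 < L)
    (hΩ : ∀ x, Ω x = Ω 0 + ∫ s in (0 : ℝ)..x, Ω₁ s) (hodd : ∀ y, Ω (-y) = -Ω y) (hΩ₁m : AEStronglyMeasurable Ω₁ volume)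
    (h0 : Integrable fun y => (L ^ 2 + y ^ 2) * Ω y ^ 2) (h1 : Integrable fun y => (L ^ 2 + y ^ 2) * Ω₁ y ^ 2) :
    ∫ x in Ioi (0 : ℝ), hilbertTransform Ω x = 0 := by
  have heven : ∀ y, hilbertTransform Ω (-y) = hilbertTransform Ω y := fun y => hilbertTransform_neg_arg_of_odd hodd y
  have h := integral_comp_abs (f := hilbertTransform Ω)
  have hfun : (fun x : ℝ => hilbertTransform Ω |x|) = hilbertTransform Ω := by
    funext x
    rcases le_or_gt 0 x with hx | hx
    · rw [abs_of_nonneg hx]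
    · rw [abs_of_neg hx, heven]
  rw [hfun, integral_hilbertTransform_eq_zero_of_primitive hL hΩ hodd hΩ₁m h0 h1] at h
  linarith

/-- **H∞ at `+∞`: `𝒰Ω(ξ) = ∫₀^ξ HΩ → 0` as `ξ → +∞`** on the whole odd energy class (the T2 form). [folklore] -/
theorem tendsto_velocity_atTop_of_primitive {Ω Ω₁ : ℝ → ℝ} {L : ℝ} (hL : 0 < L)
    (hΩ : ∀ x, Ω x = Ω 0 + ∫ s in (0 : ℝ)..x, Ω₁ s) (hodd : ∀ y, Ω (-y) = -Ω y) (hΩ₁m : AEStronglyMeasurable Ω₁ volume)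
    (h0 : Integrable fun y => (L ^ 2 + y ^ 2) * Ω y ^ 2) (h1 : Integrable fun y => (L ^ 2 + y ^ 2) * Ω₁ y ^ 2) :
    Tendsto (fun ξ => ∫ s in (0 : ℝ)..ξ, hilbertTransform Ω s) atTop (𝓝 0) := by
  have hHi := integrable_hilbertTransform_of_primitive hL hΩ hodd hΩ₁m h0 h1
  have h := intervalIntegral_tendsto_integral_Ioi (μ := volume) 0 hHi.integrableOn tendsto_id
  rwa [setIntegral_Ioi_hilbertTransform_eq_zero_of_primitive hL hΩ hodd hΩ₁m h0 h1] at h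

/-- The velocity is odd on the class: `∫₀^{ξ} HΩ = −∫₀^{−ξ} HΩ` (`HΩ` even). [folklore] -/
theorem velocity_neg_of_odd {Ω : ℝ → ℝ} (hodd : ∀ y, Ω (-y) = -Ω y) (ξ : ℝ) :
    ∫ s in (0 : ℝ)..(-ξ), hilbertTransform Ω s = -∫ s in (0 : ℝ)..ξ, hilbertTransform Ω s := by
  have heven : ∀ y, hilbertTransform Ω (-y) = hilbertTransform Ω y := fun y => hilbertTransform_neg_arg_of_odd hodd y
  have h1 : ∫ s in (0 : ℝ)..(-ξ), hilbertTransform Ω s = ∫ s in (0 : ℝ)..(-ξ), hilbertTransform Ω (-s) := by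
    simp_rw [heven]
  rw [h1, intervalIntegral.integral_comp_neg, neg_zero, neg_neg, intervalIntegral.integral_symm]

/-- **H∞ at `−∞`: `𝒰Ω(ξ) → 0` as `ξ → −∞`** on the whole odd energy class. [folklore] -/
theorem tendsto_velocity_atBot_of_primitive {Ω Ω₁ : ℝ → ℝ} {L : ℝ} (hL : 0 < L)
    (hΩ : ∀ x, Ω x = Ω 0 + ∫ s in (0 : ℝ)..x, Ω₁ s) (hodd : ∀ y, Ω (-y) = -Ω y) (hΩ₁m : AEStronglyMeasurable Ω₁ volume)
    (h0 : Integrable fun y => (L ^ 2 + y ^ 2) * Ω y ^ 2) (h1 : Integrable fun y => (L ^ 2 + y ^ 2) * Ω₁ y ^ 2) :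
    Tendsto (fun ξ => ∫ s in (0 : ℝ)..ξ, hilbertTransform Ω s) atBot (𝓝 0) := by
  have htop := tendsto_velocity_atTop_of_primitive hL hΩ hodd hΩ₁m h0 h1
  have h := (htop.comp tendsto_neg_atBot_atTop).neg
  rw [neg_zero] at h
  refine h.congr fun ξ => ?_
  simp only [Function.comp_def]
  rw [velocity_neg_of_odd hodd, neg_neg]

/-! ### §3. `HΩ` is continuous on the whole class -/

/-- The near piece `x ↦ ∫_{(0,1]} (Ω(x−t) − Ω(x+t))/t dt` is continuous for an `H¹`-type profile `Ω = Ω(0) + ∫₀Ω₁`, `Ω₁ ∈ L²`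
(domination by `(1 + ½‖Ω₁‖₂²)·t^{-1/2}`, `SheetRWeakProfilePV.abs_sub_le_sqrt_of_primitive`). [folklore] -/
theorem continuous_nearPiece_of_primitive {Ω Ω₁ : ℝ → ℝ} (hΩ : ∀ x, Ω x = Ω 0 + ∫ s in (0 : ℝ)..x, Ω₁ s)
    (hΩ₁ : MemLp Ω₁ 2) : Continuous fun x => ∫ t in Ioc (0 : ℝ) 1, (Ω (x - t) - Ω (x + t)) / t := by
  have hii : ∀ a b, IntervalIntegrable Ω₁ volume a b := intervalIntegrable_of_memLp_two hΩ₁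
  have h1 : Integrable (fun y => Ω₁ y ^ 2) := hΩ₁.integrable_sq
  have hc : Continuous Ω := continuous_of_primitive hΩ hii
  set A : ℝ := ∫ y, Ω₁ y ^ 2 with hA
  have hdom : IntegrableOn (fun t : ℝ => (1 + A / 2) * t ^ (-(1 / 2 : ℝ))) (Ioc 0 1) := by
    have h := (intervalIntegral.intervalIntegrable_rpow' (a := 0) (b := 1) (r := -(1 / 2 : ℝ)) (by norm_num)).const_mul
      (1 + A / 2)
    exact (intervalIntegrable_iff_integrableOn_Ioc_of_le zero_le_one).mp h
  refine continuous_of_dominated (bound := fun t : ℝ => (1 + A / 2) * t ^ (-(1 / 2 : ℝ))) ?_ ?_ hdom ?_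
  · intro x
    exact (((hc.comp (continuous_const.sub continuous_id)).sub (hc.comp (continuous_const.add continuous_id))).measurable.div
      measurable_id).aestronglyMeasurable.restrict
  · intro x
    refine ae_restrict_of_forall_mem measurableSet_Ioc fun t ht => ?_
    have ht0 : 0 < t := ht.1
    rw [Real.norm_eq_abs, abs_div, abs_of_pos ht0, div_le_iff₀ ht0]
    have hb := abs_sub_le_sqrt_of_primitive hΩ hii h1 ht0 x
    have hrpow : t ^ (-(1 / 2 : ℝ)) * t = Real.sqrt t := by
      rw [Real.sqrt_eq_rpow, show -(1 / 2 : ℝ) = (1 / 2 : ℝ) - 1 by norm_num, Real.rpow_sub_one ht0.ne']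
      field_simp
    calc |Ω (x - t) - Ω (x + t)| ≤ (1 + A / 2) * Real.sqrt t := hb
      _ = (1 + A / 2) * t ^ (-(1 / 2 : ℝ)) * t := by rw [mul_assoc, hrpow]
  · refine Eventually.of_forall fun t => ?_
    exact ((hc.comp (continuous_id.sub continuous_const)).sub (hc.comp (continuous_id.add continuous_const))).div_const t

/-- Split of `HΩ` for an `H¹`-type `L¹` profile into the near piece and the two substituted far pieces:
`HΩ(x) = π⁻¹·(∫_{(0,1]} (Ω(x−t) − Ω(x+t))/t dt + ∫ 𝟙_{s<x−1} Ω(s)/(x−s) ds − ∫ 𝟙_{s>x+1} Ω(s)/(s−x) ds)`. [folklore] -/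
theorem hilbertTransform_eq_near_add_far_of_primitive {Ω Ω₁ : ℝ → ℝ} (hΩ : ∀ x, Ω x = Ω 0 + ∫ s in (0 : ℝ)..x, Ω₁ s)
    (hΩ₁ : MemLp Ω₁ 2) (hΩi : Integrable Ω) (x : ℝ) :
    hilbertTransform Ω x = π⁻¹ * ((∫ t in Ioc (0 : ℝ) 1, (Ω (x - t) - Ω (x + t)) / t)
      + ((∫ s, (Iio (x - 1)).indicator (fun s => Ω s / (x - s)) s) - ∫ s, (Ioi (x + 1)).indicator (fun s => Ω s / (s - x)) s)) := by
  have hii : ∀ a b, IntervalIntegrable Ω₁ volume a b := intervalIntegrable_of_memLp_two hΩ₁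
  have hc : Continuous Ω := continuous_of_primitive hΩ hii
  have hint := integrableOn_symmIntegrand_of_primitive hΩ hΩ₁ hΩi x
  have hsplit : Ioi (0 : ℝ) = Ioc 0 1 ∪ Ioi 1 := (Ioc_union_Ioi_eq_Ioi zero_le_one).symm
  rw [hilbertTransform, hsplit, setIntegral_union (Set.Ioc_disjoint_Ioi le_rfl) measurableSet_Ioi
    (hint.mono_set (by rw [hsplit]; exact subset_union_left)) (hint.mono_set (by rw [hsplit]; exact subset_union_right))]
  congr 2
  obtain ⟨hL, hR⟩ := integrableOn_farPieces hc hΩi x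
  rw [← farPiece_left_eq Ω x, ← farPiece_right_eq Ω x, ← integral_sub hL hR]
  refine setIntegral_congr_fun measurableSet_Ioi fun t _ => ?_
  ring

/-- **`HΩ` is continuous on the whole class**: for `Ω = Ω(0) + ∫₀Ω₁` with `Ω₁ ∈ L²` and `Ω ∈ L¹`, the pointwise p.v. function
`hilbertTransform Ω` is continuous (no `C¹` hypothesis). [folklore] -/
theorem continuous_hilbertTransform_of_primitive {Ω Ω₁ : ℝ → ℝ} (hΩ : ∀ x, Ω x = Ω 0 + ∫ s in (0 : ℝ)..x, Ω₁ s)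
    (hΩ₁ : MemLp Ω₁ 2) (hΩi : Integrable Ω) : Continuous (hilbertTransform Ω) := by
  have hii : ∀ a b, IntervalIntegrable Ω₁ volume a b := intervalIntegrable_of_memLp_two hΩ₁
  have hc : Continuous Ω := continuous_of_primitive hΩ hii
  have h : hilbertTransform Ω = fun x => π⁻¹ * ((∫ t in Ioc (0 : ℝ) 1, (Ω (x - t) - Ω (x + t)) / t)
      + ((∫ s, (Iio (x - 1)).indicator (fun s => Ω s / (x - s)) s) - ∫ s, (Ioi (x + 1)).indicator (fun s => Ω s / (s - x)) s)) :=
    funext (hilbertTransform_eq_near_add_far_of_primitive hΩ hΩ₁ hΩi)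
  rw [h]
  exact continuous_const.mul ((continuous_nearPiece_of_primitive hΩ hΩ₁).add
    ((continuous_farPiece_left hc hΩi).sub (continuous_farPiece_right hc hΩi)))

/-- Hence the velocity `𝒰Ω(ξ) = ∫₀^ξ HΩ` is differentiable EVERYWHERE with `(𝒰Ω)′ = HΩ` on the whole class. [folklore] -/
theorem hasDerivAt_velocity_of_primitive {Ω Ω₁ : ℝ → ℝ} (hΩ : ∀ x, Ω x = Ω 0 + ∫ s in (0 : ℝ)..x, Ω₁ s)
    (hΩ₁ : MemLp Ω₁ 2) (hΩi : Integrable Ω) (hΩ2 : MemLp Ω 2) (ξ : ℝ) :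
    HasDerivAt (fun ξ => ∫ s in (0 : ℝ)..ξ, hilbertTransform Ω s) (hilbertTransform Ω ξ) ξ := by
  have hHc := continuous_hilbertTransform_of_primitive hΩ hΩ₁ hΩi
  exact intervalIntegral.integral_hasDerivAt_right (intervalIntegrable_hilbertTransform_of_primitive hΩ hΩ₁ hΩi hΩ2 0 ξ)
    (hHc.stronglyMeasurableAtFilter volume (𝓝 ξ)) hHc.continuousAt

/-! ### §4. The T3 composition: the sharp (E5) `𝒰`-term inequality, unconditionally on the whole odd energy class -/

/-- **(E5) `𝒰`-term, sharp constant, UNCONDITIONAL on the whole odd energy class.** For `Ω = Ω(0) + ∫₀Ω₁` odd with `Ω₁`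
a.e.-strongly measurable, `∫(L²+y²)Ω² < ∞`, `∫(L²+y²)Ω₁² < ∞` (`L > 0`):
`∫ (𝒰Ω)(ξ)²·2L/(L²+ξ²) dξ ≤ (2L)⁻¹·∫(L²+ξ²)Ω(ξ)² dξ`, i.e. **`‖𝒰Ω‖_{L²(dθ)} ≤ (2L)^{-1/2}‖Ω‖_w`** — every hypothesis of
`SheetRVelocityWirtinger.integral_velocity_sq_le_of_weightedSq_eq` (`hU`, `hu`, `hU0`, `hwu`, `htop`, `hbot`, `hiso`) discharged
from class membership (§§2–3 and `SheetREnergyClass.weightedSq_hilbertTransform_of_primitive`). [folklore] -/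
theorem integral_velocity_sq_le_of_primitive {Ω Ω₁ : ℝ → ℝ} {L : ℝ} (hL : 0 < L)
    (hΩ : ∀ x, Ω x = Ω 0 + ∫ s in (0 : ℝ)..x, Ω₁ s) (hodd : ∀ y, Ω (-y) = -Ω y) (hΩ₁m : AEStronglyMeasurable Ω₁ volume)
    (h0 : Integrable fun y => (L ^ 2 + y ^ 2) * Ω y ^ 2) (h1 : Integrable fun y => (L ^ 2 + y ^ 2) * Ω₁ y ^ 2) :
    ∫ ξ, (∫ s in (0 : ℝ)..ξ, hilbertTransform Ω s) ^ 2 * (2 * L / (L ^ 2 + ξ ^ 2)) ≤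
      (2 * L)⁻¹ * ∫ ξ, (L ^ 2 + ξ ^ 2) * Ω ξ ^ 2 := by
  obtain ⟨-, hΩ₁2, hΩ2, hΩi, -⟩ := basic_of_primitive hL hΩ hΩ₁m h0 h1
  obtain ⟨-, -, hwH, hiso⟩ := weightedSq_hilbertTransform_of_primitive hL hΩ hodd hΩ₁m h0 h1
  exact SheetRVelocityWirtinger.integral_velocity_sq_le_of_weightedSq_eq hL
    (U := fun ξ => ∫ s in (0 : ℝ)..ξ, hilbertTransform Ω s) (u := hilbertTransform Ω) (δ := Ω)
    (hasDerivAt_velocity_of_primitive hΩ hΩ₁2 hΩi hΩ2) (continuous_hilbertTransform_of_primitive hΩ hΩ₁2 hΩi)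
    (by simp) hwH (tendsto_velocity_atTop_of_primitive hL hΩ hodd hΩ₁m h0 h1)
    (tendsto_velocity_atBot_of_primitive hL hΩ hodd hΩ₁m h0 h1) hiso

/-- Square-root form: **`‖𝒰Ω‖_{L²(dθ)} ≤ (2L)^{-1/2}·‖Ω‖_w`** on the whole odd energy class. [folklore] -/
theorem sqrt_integral_velocity_sq_le_of_primitive {Ω Ω₁ : ℝ → ℝ} {L : ℝ} (hL : 0 < L)
    (hΩ : ∀ x, Ω x = Ω 0 + ∫ s in (0 : ℝ)..x, Ω₁ s) (hodd : ∀ y, Ω (-y) = -Ω y) (hΩ₁m : AEStronglyMeasurable Ω₁ volume)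
    (h0 : Integrable fun y => (L ^ 2 + y ^ 2) * Ω y ^ 2) (h1 : Integrable fun y => (L ^ 2 + y ^ 2) * Ω₁ y ^ 2) :
    Real.sqrt (∫ ξ, (∫ s in (0 : ℝ)..ξ, hilbertTransform Ω s) ^ 2 * (2 * L / (L ^ 2 + ξ ^ 2))) ≤
      (Real.sqrt (2 * L))⁻¹ * Real.sqrt (∫ ξ, (L ^ 2 + ξ ^ 2) * Ω ξ ^ 2) := by
  have h := integral_velocity_sq_le_of_primitive hL hΩ hodd hΩ₁m h0 h1
  have h2L : 0 < 2 * L := by positivity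
  calc Real.sqrt (∫ ξ, (∫ s in (0 : ℝ)..ξ, hilbertTransform Ω s) ^ 2 * (2 * L / (L ^ 2 + ξ ^ 2)))
      ≤ Real.sqrt ((2 * L)⁻¹ * ∫ ξ, (L ^ 2 + ξ ^ 2) * Ω ξ ^ 2) := Real.sqrt_le_sqrt h
    _ = (Real.sqrt (2 * L))⁻¹ * Real.sqrt (∫ ξ, (L ^ 2 + ξ ^ 2) * Ω ξ ^ 2) := by
      rw [Real.sqrt_mul (inv_nonneg.2 h2L.le), Real.sqrt_inv]

/-- Energy form: **`∫ (𝒰Ω)²·2L/(L²+ξ²) ≤ (2/L)·‖Ω‖²_E`**, `‖Ω‖²_E = ∫(L²+y²)(Ω₁² + ¼Ω²)`, on the whole odd energy class — i.e.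
`‖𝒰Ω‖_{L²(dθ)} ≤ 2(2L)^{-1/2}‖Ω‖_E`, PRICE-impl1 (E5)'s `S₂′` multiplier with the SHARP Dirichlet constant (`‖Ω‖_w ≤ 2‖Ω‖_E`). [folklore] -/
theorem integral_velocity_sq_le_energy_of_primitive {Ω Ω₁ : ℝ → ℝ} {L : ℝ} (hL : 0 < L)
    (hΩ : ∀ x, Ω x = Ω 0 + ∫ s in (0 : ℝ)..x, Ω₁ s) (hodd : ∀ y, Ω (-y) = -Ω y) (hΩ₁m : AEStronglyMeasurable Ω₁ volume)
    (h0 : Integrable fun y => (L ^ 2 + y ^ 2) * Ω y ^ 2) (h1 : Integrable fun y => (L ^ 2 + y ^ 2) * Ω₁ y ^ 2) :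
    ∫ ξ, (∫ s in (0 : ℝ)..ξ, hilbertTransform Ω s) ^ 2 * (2 * L / (L ^ 2 + ξ ^ 2)) ≤
      2 / L * ∫ y, (L ^ 2 + y ^ 2) * (Ω₁ y ^ 2 + 1 / 4 * Ω y ^ 2) := by
  have h := integral_velocity_sq_le_of_primitive hL hΩ hodd hΩ₁m h0 h1
  have hE : Integrable fun y => (L ^ 2 + y ^ 2) * (Ω₁ y ^ 2 + 1 / 4 * Ω y ^ 2) := by
    have := h1.add (h0.div_const 4)
    refine this.congr (Eventually.of_forall fun y => ?_)
    simp only [Pi.add_apply]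
    ring
  have hle : ∫ y, (L ^ 2 + y ^ 2) * Ω y ^ 2 ≤ 4 * ∫ y, (L ^ 2 + y ^ 2) * (Ω₁ y ^ 2 + 1 / 4 * Ω y ^ 2) := by
    rw [← integral_const_mul]
    refine integral_mono h0 (hE.const_mul 4) fun y => ?_
    have hw : 0 ≤ L ^ 2 + y ^ 2 := by positivity
    nlinarith [mul_nonneg hw (sq_nonneg (Ω₁ y))]
  have h2L : 0 < (2 * L)⁻¹ := by positivity
  calc ∫ ξ, (∫ s in (0 : ℝ)..ξ, hilbertTransform Ω s) ^ 2 * (2 * L / (L ^ 2 + ξ ^ 2))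
      ≤ (2 * L)⁻¹ * ∫ ξ, (L ^ 2 + ξ ^ 2) * Ω ξ ^ 2 := h
    _ ≤ (2 * L)⁻¹ * (4 * ∫ y, (L ^ 2 + y ^ 2) * (Ω₁ y ^ 2 + 1 / 4 * Ω y ^ 2)) := mul_le_mul_of_nonneg_left hle h2L.le
    _ = 2 / L * ∫ y, (L ^ 2 + y ^ 2) * (Ω₁ y ^ 2 + 1 / 4 * Ω y ^ 2) := by
      field_simp
      ring

/-! ### §5. The `C¹` subclass (the frame's original hypotheses) -/

/-- A `C¹` function is the primitive of its derivative: `δ(x) = δ(0) + ∫₀ˣ δ′`. [folklore] -/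
theorem primitive_of_contDiff {δ : ℝ → ℝ} (hδ : ContDiff ℝ 1 δ) (x : ℝ) : δ x = δ 0 + ∫ s in (0 : ℝ)..x, deriv δ s := by
  have hd : Differentiable ℝ δ := hδ.differentiable one_ne_zero
  have hc : Continuous (deriv δ) := hδ.continuous_deriv le_rfl
  rw [intervalIntegral.integral_deriv_eq_sub (fun y _ => hd y) (hc.intervalIntegrable _ _)]
  ring

/-- **H∞ and the sharp (E5) `𝒰`-term inequality on the `C¹` subclass** (the hypotheses of `SheetRWeightedEmbeddings` /
`CertificateViscousSheetR`): for `δ ∈ C¹` odd with `∫(L²+y²)δ² < ∞` and `∫(L²+y²)δ′² < ∞` (`L > 0`), `Hδ = hilbertTransform δ` is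
continuous and integrable, `∫_ℝ Hδ = 0`, `𝒰δ(ξ) = ∫₀^ξ Hδ → 0` at `±∞`, and `∫ (𝒰δ)²·2L/(L²+ξ²) ≤ (2L)⁻¹·∫(L²+ξ²)δ²`. [folklore] -/
theorem velocity_endpoint_of_contDiff {δ : ℝ → ℝ} {L : ℝ} (hL : 0 < L) (hδ : ContDiff ℝ 1 δ) (hodd : ∀ y, δ (-y) = -δ y)
    (h0 : Integrable fun y => (L ^ 2 + y ^ 2) * δ y ^ 2) (h1 : Integrable fun y => (L ^ 2 + y ^ 2) * deriv δ y ^ 2) :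
    Continuous (hilbertTransform δ) ∧ Integrable (hilbertTransform δ) ∧ ∫ x, hilbertTransform δ x = 0 ∧
      Tendsto (fun ξ => ∫ s in (0 : ℝ)..ξ, hilbertTransform δ s) atTop (𝓝 0) ∧
      Tendsto (fun ξ => ∫ s in (0 : ℝ)..ξ, hilbertTransform δ s) atBot (𝓝 0) ∧
      ∫ ξ, (∫ s in (0 : ℝ)..ξ, hilbertTransform δ s) ^ 2 * (2 * L / (L ^ 2 + ξ ^ 2)) ≤
        (2 * L)⁻¹ * ∫ ξ, (L ^ 2 + ξ ^ 2) * δ ξ ^ 2 := by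
  have hΩ := primitive_of_contDiff hδ
  have hΩ₁m : AEStronglyMeasurable (deriv δ) volume := (hδ.continuous_deriv le_rfl).aestronglyMeasurable
  obtain ⟨-, hΩ₁2, -, hΩi, -⟩ := basic_of_primitive hL hΩ hΩ₁m h0 h1
  exact ⟨continuous_hilbertTransform_of_primitive hΩ hΩ₁2 hΩi, integrable_hilbertTransform_of_primitive hL hΩ hodd hΩ₁m h0 h1,
    integral_hilbertTransform_eq_zero_of_primitive hL hΩ hodd hΩ₁m h0 h1,
    tendsto_velocity_atTop_of_primitive hL hΩ hodd hΩ₁m h0 h1, tendsto_velocity_atBot_of_primitive hL hΩ hodd hΩ₁m h0 h1,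
    integral_velocity_sq_le_of_primitive hL hΩ hodd hΩ₁m h0 h1⟩

end SheetRVelocityEndpointClass
end Summit.NavierStokesRegularity.OSWSelfSimilar
end
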